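import Summits.Ventures.CertifiedManyBodySolver.Upper.TorusRectBlockNoWrap
import Literature.MathematicalPhysics.QuantumLattice.SourcedHubbardBlockCut
import Literature.MathematicalPhysics.QuantumLattice.InterClusterKernelIdentification
import Literature.MathematicalPhysics.QuantumLattice.DWaveSource
import HarnessLib

/-!
# Cluster trial states for the pinning-field rows, part 3: the open `a × b` cluster with the `d`-wave
# pair source, and the block cut of the sourced torus

HONEST FRAMING: first certified bounds; not a superconductivity verdict; every number certified or
labelled float. Nothing in this file is a number: it is a soundness edge (trial state ⇒ energy CEILING).

Companion of `Upper/TorusRectBlockPartition.lean`, `Upper/TorusRectBlockNoWrap.lean` (seat hubbard-obs-pin-1;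
producer-side soundness of the `q`-slot of `SourcedEnergyUpperRow`, consumed through
`PinFieldResponseFloorAt.of_energyRows`). The grand-canonical `d`-wave pair-sourced torus
`dWaveSourceTorus L U μ h = H_L(1,U) − μN − h(Δ_d + Δ_d†)` (Koma–Tasaki 1994 §1; tree `DWaveSource.lean`)
is put in the `(graph, pair-weights)` form of the tree's block-cut file `SourcedHubbardBlockCut`, the
OPEN sourced cluster is defined, and the block cut along the `a × b` block partition is proved:

* `dWaveTorusPairWeight L`, `pairField_dWave_eq_sum_bondPair`: `Δ_d = Σ_{(x,y)} A(x,y) b_{xy}`,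
  `A(x,y) = Σ_{e ∈ {0,±e₁,±e₂}} 1[y = x + e on the torus] ĝ_d(e)/√2`, `b_{xy} = c_{x↑}c_{y↓} − c_{x↓}c_{y↑}`
  (BOTH orientations of every bond occur, as in `pairField = Σ_x localPair`); `dWaveSourceTorus_eq_sourcedForm`;
* `dWaveBoxPairWeight a b` and **`dWaveSourceOpenBox a b U μ h`** `= hamiltonianWith (rectBoxGraph a b) 1 U μ
  − h (P_C + P_Cᴴ)`, `P_C = Σ_{(p,q)} w_C(p,q) b_{pq}`, `w_C(p,q) = Σ_e 1[q = p + e in ℤ²] ĝ_d(e)/√2` — the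
  torus source RESTRICTED to the pairs inside one block (this is the operator a cluster certificate must
  bound: `−h(P_C + P_Cᴴ) = −h√2 · Σ_{box bonds β} s_β (b_β + b_βᴴ)`, `s_β = ±1` the `d`-wave sign, each
  unordered bond counted once); Hermitian, EVEN (`isParityPreserving_dWaveSourceOpenBox`);
* `dWaveTorusPairWeight_blockSite`: torus weights restricted to one block = box weights (`a, b < L`);
* **`dWaveSourceTorus_sub_sum_jwEmbed_eq`** (the block cut, `L = Kx a = Ky b`, `a, b < L`):
  `A_L − Σ_R jwEmbed (blockOrbEmb R) A_C = −Σ_{inter-block bonds} T_b − h(Σ_{inter-block pairs} A b + h.c.)`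
  (tree `sourced_sub_sum_jwEmbed_sub_onSiteSum_eq`; no atomic rest since the blocks cover the torus).

References: D. Ruelle, *Statistical Mechanics: Rigorous Results* (1969) §2.2–2.3, §3.3 (block
decompositions, sub-box variational principle); T. Koma, H. Tasaki, J. Stat. Phys. 76 (1994) 745, §1
(the sourced Hamiltonian); D. J. Scalapino, Phys. Rep. 250 (1995) 329, §2 (the `d_{x²−y²}` pair field).
Tree: `SourcedHubbardBlockCut`, `DWaveSource`, `isParityPreserving_hamiltonian` (`InterClusterKernelIdentification`).
-/

noncomputable section

namespace Summit.Ventures.CertifiedManyBodySolver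

open Matrix Finset Literature.Probability.LatticeModels
open Literature.MathematicalPhysics.QuantumLattice Literature.MathematicalPhysics.QuantumLattice.ThermodynamicLimit
open Literature.MathematicalPhysics.QuantumLattice.TwoCluster Literature.Barriers.HubbardSuperconductivity
open TorusRectBlock ClusterParity

section Weights

/-- The pair weights of the torus `d`-wave pair field: `A(x,y) = Σ_{e ∈ {0,±e₁,±e₂}} 1[y = x + e on
the torus] ĝ_d(e)/√2`. [cite: KomaTasaki1994, §1] -/
def dWaveTorusPairWeight (L : ℕ) [NeZero L] (z : FermionTorus 2 L × FermionTorus 2 L) : ℂ :=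
  ∑ e ∈ insert (0 : Site 2) unitSteps,
    if FermionTorus.ofTorusSite (FermionTorus.toTorusSite z.1 + Torus.proj L e) = z.2
    then ((dWaveFormFactor e / Real.sqrt 2 : ℝ) : ℂ) else 0

/-- The pair weights of the OPEN `a × b` cluster: `w_C(p,q) = Σ_{e ∈ {0,±e₁,±e₂}} 1[q = p + e in ℤ²] ĝ_d(e)/√2`
— the torus weights restricted to pairs inside one block. [cite: KomaTasaki1994, §1] -/
def dWaveBoxPairWeight (a b : ℕ) (z : (Fin a ×ₗ Fin b) × (Fin a ×ₗ Fin b)) : ℂ :=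
  ∑ e ∈ insert (0 : Site 2) unitSteps,
    if ((((ofLex z.2).1 : ℕ) : ℤ) = (((ofLex z.1).1 : ℕ) : ℤ) + e 0 ∧
        (((ofLex z.2).2 : ℕ) : ℤ) = (((ofLex z.1).2 : ℕ) : ℤ) + e 1)
    then ((dWaveFormFactor e / Real.sqrt 2 : ℝ) : ℂ) else 0

/-- **The open `a × b` Hubbard cluster with the `d`-wave pair source** (free boundary conditions;
hopping `1`, repulsion `U`, chemical potential `μ`, pinning field `h`):
`A_C = hamiltonianWith (rectBoxGraph a b) 1 U μ − h (P_C + P_Cᴴ)`, `P_C = Σ_{(p,q)} w_C(p,q) b_{pq}` — the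
torus source `Δ_d + Δ_dᴴ` restricted to the bonds inside the box. [cite: KomaTasaki1994, §1] -/
def dWaveSourceOpenBox (a b : ℕ) (U μ h : ℝ) :
    Matrix (Finset (Orb (Fin a ×ₗ Fin b))) (Finset (Orb (Fin a ×ₗ Fin b))) ℂ :=
  hamiltonianWith (rectBoxGraph a b) 1 U μ -
    (h : ℂ) • ((∑ z : (Fin a ×ₗ Fin b) × (Fin a ×ₗ Fin b), dWaveBoxPairWeight a b z • bondPair z.1 z.2) +
      (∑ z : (Fin a ×ₗ Fin b) × (Fin a ×ₗ Fin b), dWaveBoxPairWeight a b z • bondPair z.1 z.2)ᴴ)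

/-- The open sourced cluster is Hermitian. [cite: KomaTasaki1994, §1] -/
theorem dWaveSourceOpenBox_isHermitian (a b : ℕ) (U μ h : ℝ) : (dWaveSourceOpenBox a b U μ h).IsHermitian :=
  isHermitian_sourced (rectBoxGraph a b) 1 U μ h (dWaveBoxPairWeight a b)

/-- A weighted sum of bond pairs is even. [folklore] -/
theorem isParityPreserving_sum_smul_bondPair {Λ : Type*} [LinearOrder Λ] [Fintype Λ] (w : Λ × Λ → ℂ) :
    IsParityPreserving (∑ z : Λ × Λ, w z • bondPair z.1 z.2) := by
  refine IsParityPreserving.sum fun z _ => IsParityPreserving.smul ?_ _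
  unfold bondPair
  exact isParityPreserving_sub (TorusPlaquette.isParityPreserving_annihilation_mul_annihilation _ _)
    (TorusPlaquette.isParityPreserving_annihilation_mul_annihilation _ _)

/-- The grand-canonical Hubbard Hamiltonian is even. [folklore] -/
theorem isParityPreserving_hamiltonianWith {Λ : Type*} [LinearOrder Λ] [Fintype Λ] (G : SimpleGraph Λ)
    [DecidableRel G.Adj] (t U μ : ℝ) : IsParityPreserving (hamiltonianWith G t U μ) := by
  rw [hamiltonianWith_eq, sub_eq_add_neg]
  refine (isParityPreserving_hamiltonian G t U).add (IsParityPreserving.smul ?_ _).neg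
  unfold totalNumber numberOp
  exact IsParityPreserving.sum fun x _ => IsParityPreserving.sum fun σ _ =>
    IsParityPreserving.creation_mul_annihilation _ _

/-- **The open sourced cluster is even** (it preserves fermion parity, though not the particle
number). [cite: KomaTasaki1994, §1] -/
theorem isParityPreserving_dWaveSourceOpenBox (a b : ℕ) (U μ h : ℝ) :
    IsParityPreserving (dWaveSourceOpenBox a b U μ h) := by
  unfold dWaveSourceOpenBox
  exact isParityPreserving_sub (isParityPreserving_hamiltonianWith _ 1 U μ)
    (((isParityPreserving_sum_smul_bondPair _).add
      (isParityPreserving_conjTranspose (isParityPreserving_sum_smul_bondPair _))).smul _)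

variable (L : ℕ) [NeZero L]

/-- **`Δ_d = Σ_{(x,y)} A(x,y) b_{xy}`** on the torus. [cite: KomaTasaki1994, §1] -/
theorem pairField_dWave_eq_sum_bondPair :
    pairField dWaveFormFactor L =
      ∑ z : FermionTorus 2 L × FermionTorus 2 L, dWaveTorusPairWeight L z • bondPair z.1 z.2 := by
  rw [pairField, Fintype.sum_prod_type]
  rw [← (FermionTorus.equivTorusSite (d := 2) (L := L)).sum_comp]
  refine Finset.sum_congr rfl fun x _ => ?_
  show localPair dWaveFormFactor L (FermionTorus.toTorusSite x) = _
  have hloc : localPair dWaveFormFactor L (FermionTorus.toTorusSite x) =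
      ∑ e ∈ insert (0 : Site 2) unitSteps, ((dWaveFormFactor e / Real.sqrt 2 : ℝ) : ℂ) •
        bondPair x (FermionTorus.ofTorusSite (FermionTorus.toTorusSite x + Torus.proj L e)) := by
    rw [localPair, FermionTorus.ofTorusSite_toTorusSite]
    rfl
  rw [hloc]
  -- insert the Kronecker delta in `y` and exchange the sums
  have hδ : ∀ e : Site 2, ((dWaveFormFactor e / Real.sqrt 2 : ℝ) : ℂ) •
      bondPair x (FermionTorus.ofTorusSite (FermionTorus.toTorusSite x + Torus.proj L e)) =
      ∑ y : FermionTorus 2 L, (if FermionTorus.ofTorusSite (FermionTorus.toTorusSite x + Torus.proj L e) = y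
        then ((dWaveFormFactor e / Real.sqrt 2 : ℝ) : ℂ) else 0) • bondPair x y := by
    intro e
    simp only [ite_smul, zero_smul, Finset.sum_ite_eq, Finset.mem_univ, if_true]
  rw [Finset.sum_congr rfl fun e _ => hδ e, Finset.sum_comm]
  refine Finset.sum_congr rfl fun y _ => ?_
  rw [dWaveTorusPairWeight, Finset.sum_smul]

/-- The sourced torus in the `(graph, weights)` form of `SourcedHubbardBlockCut`:
`dWaveSourceTorus L U μ h = hamiltonianWith (fermionTorusGraph 2 L) 1 U μ − h (P_A + P_Aᴴ)`.
[cite: KomaTasaki1994, §1] -/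
theorem dWaveSourceTorus_eq_sourcedForm (U μ h : ℝ) :
    dWaveSourceTorus L U μ h = hamiltonianWith (fermionTorusGraph 2 L) 1 U μ -
      (h : ℂ) • ((∑ z : FermionTorus 2 L × FermionTorus 2 L, dWaveTorusPairWeight L z • bondPair z.1 z.2) +
        (∑ z : FermionTorus 2 L × FermionTorus 2 L, dWaveTorusPairWeight L z • bondPair z.1 z.2)ᴴ) := by
  rw [dWaveSourceTorus, hubbardTorusWith, pairField_dWave_eq_sum_bondPair]

/-- The steps `{0, ±e₁, ±e₂}` have entries bounded by one. [folklore] -/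
theorem abs_apply_le_one_of_mem_insert_unitSteps {e : Site 2} (he : e ∈ insert (0 : Site 2) unitSteps) (i : Fin 2) :
    |e i| ≤ 1 := by
  simp only [unitSteps, Finset.mem_insert, Finset.mem_singleton] at he
  rcases he with rfl | rfl | rfl | rfl | rfl
  · simp
  · exact abs_single_one_apply_le 0 i
  · rw [Pi.neg_apply, abs_neg]; exact abs_single_one_apply_le 0 i
  · exact abs_single_one_apply_le 1 i
  · rw [Pi.neg_apply, abs_neg]; exact abs_single_one_apply_le 1 i

end Weights

/-! ### The block cut of the sourced torus and the product trial state -/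

section Cut

variable {L Kx Ky a b : ℕ} (hLa : L = Kx * a) (hLb : L = Ky * b)

/-- **The torus pair weights restricted to one block are the box pair weights** (`a, b < L`: no
wrap-around). [cite: Ruelle1969, §3.3] -/
theorem dWaveTorusPairWeight_blockSite [NeZero L] (haL : a < L) (hbL : b < L) (R : Fin Kx ×ₗ Fin Ky)
    (p q : Fin a ×ₗ Fin b) :
    dWaveTorusPairWeight L (blockSite hLa hLb R p, blockSite hLa hLb R q) = dWaveBoxPairWeight a b (p, q) := by
  unfold dWaveTorusPairWeight dWaveBoxPairWeight
  refine Finset.sum_congr rfl fun e he => ?_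
  have key : FermionTorus.ofTorusSite (FermionTorus.toTorusSite (blockSite hLa hLb R p) + Torus.proj L e) =
      blockSite hLa hLb R q ↔
      ((((ofLex q).1 : ℕ) : ℤ) = (((ofLex p).1 : ℕ) : ℤ) + e 0 ∧
        (((ofLex q).2 : ℕ) : ℤ) = (((ofLex p).2 : ℕ) : ℤ) + e 1) := by
    rw [← toTorusSite_blockSite_eq_add_proj_iff hLa hLb haL hbL R p q (abs_apply_le_one_of_mem_insert_unitSteps he)]
    constructor
    · intro h
      rw [← h, FermionTorus.toTorusSite_ofTorusSite]
    · intro h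
      rw [← h, FermionTorus.ofTorusSite_toTorusSite]
  by_cases hc : ((((ofLex q).1 : ℕ) : ℤ) = (((ofLex p).1 : ℕ) : ℤ) + e 0 ∧
      (((ofLex q).2 : ℕ) : ℤ) = (((ofLex p).2 : ℕ) : ℤ) + e 1)
  · rw [if_pos (key.2 hc), if_pos hc]
  · rw [if_neg (fun h => hc (key.1 h)), if_neg hc]

/-- **The block cut of the sourced torus** (`L = Kx a = Ky b`, `a, b < L`): `dWaveSourceTorus L U μ h`
minus the embedded open sourced clusters is minus the inter-block hopping and minus `h` times the
inter-block source bonds (no atomic rest: the blocks cover the torus). [cite: Ruelle1969, §3.3] -/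
theorem dWaveSourceTorus_sub_sum_jwEmbed_eq [NeZero L] (haL : a < L) (hbL : b < L) (U μ h : ℝ) :
    dWaveSourceTorus L U μ h -
        ∑ R : Fin Kx ×ₗ Fin Ky, jwEmbed (blockOrbEmb hLa hLb R) (dWaveSourceOpenBox a b U μ h) =
      -(∑ b ∈ (Finset.univ.biUnion fun R : Fin Kx ×ₗ Fin Ky =>
            (Finset.univ : Finset (Bond (Fin a ×ₗ Fin b))).map ⟨bondMap (blockSiteEmb hLa hLb R), bondMap_injective _⟩)ᶜ,
          hubbardCoupling (fermionTorusGraph 2 L) ((1 : ℝ) : ℂ) b • bondOp b) -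
        (h : ℂ) • ((∑ z ∈ (Finset.univ.biUnion fun R : Fin Kx ×ₗ Fin Ky =>
              (Finset.univ : Finset ((Fin a ×ₗ Fin b) × (Fin a ×ₗ Fin b))).map
                ⟨Prod.map (blockSiteEmb hLa hLb R) (blockSiteEmb hLa hLb R),
                  (blockSiteEmb hLa hLb R).injective.prodMap (blockSiteEmb hLa hLb R).injective⟩)ᶜ,
            dWaveTorusPairWeight L z • bondPair z.1 z.2) +
          (∑ z ∈ (Finset.univ.biUnion fun R : Fin Kx ×ₗ Fin Ky =>
              (Finset.univ : Finset ((Fin a ×ₗ Fin b) × (Fin a ×ₗ Fin b))).map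
                ⟨Prod.map (blockSiteEmb hLa hLb R) (blockSiteEmb hLa hLb R),
                  (blockSiteEmb hLa hLb R).injective.prodMap (blockSiteEmb hLa hLb R).injective⟩)ᶜ,
            dWaveTorusPairWeight L z • bondPair z.1 z.2)ᴴ) := by
  have hcut := sourced_sub_sum_jwEmbed_sub_onSiteSum_eq (Finset.univ : Finset (Fin Kx ×ₗ Fin Ky))
    (blockSiteEmb hLa hLb) (fun R _ R' _ hne x y => blockSite_ne_of_ne hLa hLb hne x y)
    (fermionTorusGraph 2 L) (rectBoxGraph a b)
    (fun R _ x y => (fermionTorusGraph_adj_blockSite_iff hLa hLb haL hbL R x y).symm) 1 U μ h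
    (dWaveTorusPairWeight L) (dWaveBoxPairWeight a b)
    (fun R _ z => (dWaveTorusPairWeight_blockSite hLa hLb haL hbL R z.1 z.2).symm)
  have hrest : onSiteSum (U : ℂ) (μ : ℂ) (Finset.univ.biUnion fun R : Fin Kx ×ₗ Fin Ky =>
      (Finset.univ : Finset (Fin a ×ₗ Fin b)).map (blockSiteEmb hLa hLb R).toEmbedding)ᶜ = 0 := by
    rw [biUnion_map_blockSiteEmb_eq_univ, Finset.compl_univ, onSiteSum, Finset.sum_empty]
  rw [← dWaveSourceTorus_eq_sourcedForm, hrest, sub_zero] at hcut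
  exact hcut

end Cut

end Summit.Ventures.CertifiedManyBodySolver

end
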